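import Mathlib
import Summits.NavierStokesRegularity.NavierStokesRegularity.Theorems.ThreadingFluxCentreJetDefs
import HarnessLib

/-!
# Hodge slaving, sphere-free — I: the symmetric-block trace inequality (linear algebra on `ℝ³`)

For a linear map `A` on `ℝ³` with `⟪A h, y⟫ = −⟪w, h⟫` (`w ⊥ y`, `y ≠ 0`) which is symmetric on `yᗮ`:
`(tr A)²/2 ≤ tr(A∘A) + 2|y|⁻²⟪w, A y⟫` (`half_trace_sq_le`).  This is `tr(M∘M) ≥ ½(tr M)²` for the symmetric compression
`M = P A P` (`P` = orthogonal projection onto `yᗮ`, `proj`), via the traceless part `N = M − ½(tr M)P` and `tr(N∘N) ≥ 0`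
(`trace_comp_self_nonneg`); rank-one bookkeeping `rankOne`, `trace_rankOne`, `comp_rankOne`.  Applied pointwise to
`A = DW(x)` for a tangential unthreaded field `W` it is the algebraic core of the Bochner inequality
(`ThreadingFluxCentreVirialHodgePointwise.lean`).

Part of the sphere-free proof of HODGE SLAVING FOR `C²` FIELDS (H′) behind ★ T2 `PoloidalTameLiouville` of the
centre-virial card (ns-idea-15 g9; twin `ThreadingFluxCentreVirialDefs`).  Folklore differential geometry / linear algebra,
re-derived in ambient coordinates; information-grade; W1 movement 0; `PoloidalLiouville` (1222), T0, Galdi's problem OPEN;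
NS regularity is NOT proved.  `--supports stmt-NavierStokesRegularity-1222 --as helper`.  Filed by ns-wall-eng-4 g6
(cell ns-wall-extremal).
[cite: KorobkovPileckasRusso2015, Thm 3.6]
-/

-- the summit and its single sub-problem share the name (CONVENTIONS §1)
set_option linter.dupNamespace false

noncomputable section

namespace Summit.NavierStokesRegularity.NavierStokesRegularity.Theorems.PoloidalLiouville.CentreVirial

open Set Function MeasureTheory Filter Topology
open Literature.Analysis.FluidPDE
open Literature.Analysis.FluidPDE.VectorCalculus (divergence)
open Summit.NavierStokesRegularity.NavierStokesRegularity.Theorems.PoloidalLiouville.CentreJet (E3)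
open scoped RealInnerProductSpace

namespace Hodge

/-- The rank-one map `h ↦ ⟪a, h⟫ v`. -/
def rankOne (a v : E3) : E3 →ₗ[ℝ] E3 := ((innerSL ℝ a : E3 →L[ℝ] ℝ) : E3 →ₗ[ℝ] ℝ).smulRight v

/-- Unfolding `rankOne`. -/
theorem rankOne_apply (a v h : E3) : rankOne a v h = ⟪a, h⟫ • v := rfl

/-- `tr(h ↦ ⟪a, h⟫ v) = ⟪a, v⟫`. -/
theorem trace_rankOne (a v : E3) : LinearMap.trace ℝ E3 (rankOne a v) = ⟪a, v⟫ :=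
  LinearMap.trace_smulRight _ _

/-- `B ∘ (h ↦ ⟪a, h⟫ v) = (h ↦ ⟪a, h⟫ Bv)`. -/
theorem comp_rankOne (B : E3 →ₗ[ℝ] E3) (a v : E3) : B ∘ₗ rankOne a v = rankOne a (B v) := by
  refine LinearMap.ext fun h => ?_
  simp [rankOne_apply, map_smul]

/-- `tr((h ↦ ⟪a, h⟫ v) ∘ B) = ⟪a, B v⟫`. -/
theorem trace_rankOne_comp (B : E3 →ₗ[ℝ] E3) (a v : E3) :
    LinearMap.trace ℝ E3 (rankOne a v ∘ₗ B) = ⟪a, B v⟫ := by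
  rw [LinearMap.trace_comp_comm', comp_rankOne, trace_rankOne]

/-- `tr(B ∘ (h ↦ ⟪a, h⟫ v)) = ⟪a, B v⟫`. -/
theorem trace_comp_rankOne (B : E3 →ₗ[ℝ] E3) (a v : E3) :
    LinearMap.trace ℝ E3 (B ∘ₗ rankOne a v) = ⟪a, B v⟫ := by
  rw [comp_rankOne, trace_rankOne]

/-- The orthogonal projection onto `yᗮ`, as a linear map: `P h = h − |y|⁻² ⟪y, h⟫ y`. -/
def proj (y : E3) : E3 →ₗ[ℝ] E3 := LinearMap.id - (‖y‖ ^ 2)⁻¹ • rankOne y y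

/-- Unfolding `proj`. -/
theorem proj_apply (y h : E3) : proj y h = h - ((‖y‖ ^ 2)⁻¹ * ⟪y, h⟫) • y := by
  simp [proj, rankOne_apply, smul_smul]

/-- `P h ⊥ y`. -/
theorem inner_proj_left (y h : E3) (hy : y ≠ 0) : ⟪proj y h, y⟫ = 0 := by
  have hn : ‖y‖ ^ 2 ≠ 0 := pow_ne_zero 2 (norm_ne_zero_iff.2 hy)
  rw [proj_apply, inner_sub_left, real_inner_smul_left, real_inner_self_eq_norm_sq, real_inner_comm]
  field_simp
  ring

/-- `P` fixes `yᗮ`. -/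
theorem proj_eq_self_of_inner {y h : E3} (h0 : ⟪h, y⟫ = 0) : proj y h = h := by
  rw [proj_apply, real_inner_comm, h0, mul_zero, zero_smul, sub_zero]

/-- `P ∘ P = P`. -/
theorem proj_comp_proj {y : E3} (hy : y ≠ 0) : proj y ∘ₗ proj y = proj y := by
  refine LinearMap.ext fun h => ?_
  simp only [LinearMap.coe_comp, Function.comp_apply]
  exact proj_eq_self_of_inner (inner_proj_left y h hy)

/-- `P` is self-adjoint. -/
theorem inner_proj_symm (y a b : E3) : ⟪proj y a, b⟫ = ⟪a, proj y b⟫ := by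
  rw [proj_apply, proj_apply, inner_sub_left, inner_sub_right, real_inner_smul_left, real_inner_smul_right,
    real_inner_comm y a]
  ring

/-- `tr P = 2`. -/
theorem trace_proj {y : E3} (hy : y ≠ 0) : LinearMap.trace ℝ E3 (proj y) = 2 := by
  have hn : ‖y‖ ^ 2 ≠ 0 := pow_ne_zero 2 (norm_ne_zero_iff.2 hy)
  rw [proj, map_sub, map_smul, trace_rankOne, LinearMap.trace_id, finrank_euclideanSpace_fin,
    real_inner_self_eq_norm_sq, smul_eq_mul, inv_mul_cancel₀ hn]
  norm_num

/-- For a self-adjoint linear map `N`, `tr(N ∘ N) ≥ 0`. -/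
theorem trace_comp_self_nonneg {N : E3 →ₗ[ℝ] E3} (hN : ∀ a b : E3, ⟪N a, b⟫ = ⟪a, N b⟫) :
    0 ≤ LinearMap.trace ℝ E3 (N ∘ₗ N) := by
  rw [LinearMap.trace_eq_sum_inner _ (EuclideanSpace.basisFun (Fin 3) ℝ)]
  refine Finset.sum_nonneg fun i _ => ?_
  rw [LinearMap.coe_comp, Function.comp_apply, ← hN]
  exact real_inner_self_nonneg

/-- **The symmetric-block inequality.** -/
theorem half_trace_sq_le {A : E3 →ₗ[ℝ] E3} {y w : E3} (hy : y ≠ 0) (hwy : ⟪w, y⟫ = 0)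
    (hA : ∀ h, ⟪A h, y⟫ = -⟪w, h⟫)
    (hsym : ∀ a b : E3, ⟪a, y⟫ = 0 → ⟪b, y⟫ = 0 → ⟪A a, b⟫ = ⟪A b, a⟫) :
    (LinearMap.trace ℝ E3 A) ^ 2 / 2 ≤
      LinearMap.trace ℝ E3 (A ∘ₗ A) + 2 * (‖y‖ ^ 2)⁻¹ * ⟪w, A y⟫ := by
  have hn : ‖y‖ ^ 2 ≠ 0 := pow_ne_zero 2 (norm_ne_zero_iff.2 hy)
  set c : ℝ := (‖y‖ ^ 2)⁻¹ with hc
  set P := proj y with hP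
  set R := rankOne y (A y) with hR
  set X := A ∘ₗ P with hX
  set M := P ∘ₗ X with hM
  have hPP : P ∘ₗ P = P := proj_comp_proj hy
  have hyAy : ⟪y, A y⟫ = 0 := by rw [real_inner_comm, hA, hwy, neg_zero]
  have hXdef : X = A - c • R := by
    rw [hX, hP, proj, LinearMap.comp_sub, LinearMap.comp_id, LinearMap.comp_smul, comp_rankOne]
  have hXP : X ∘ₗ P = X := by rw [hX, LinearMap.comp_assoc, hPP]
  -- trace of `M`
  have htrM : LinearMap.trace ℝ E3 M = LinearMap.trace ℝ E3 A := by
    rw [hM, LinearMap.trace_comp_comm', hXP, hXdef, map_sub, map_smul, hR, trace_rankOne, hyAy, smul_zero, sub_zero]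
  -- trace of `M ∘ M`
  have hMM : M ∘ₗ M = P ∘ₗ (X ∘ₗ X) := by
    rw [hM, LinearMap.comp_assoc, ← LinearMap.comp_assoc X P X, hXP]
  have htrAR : LinearMap.trace ℝ E3 (A ∘ₗ R) = -⟪w, A y⟫ := by
    rw [hR, trace_comp_rankOne, real_inner_comm, hA]
  have htrRA : LinearMap.trace ℝ E3 (R ∘ₗ A) = -⟪w, A y⟫ := by
    rw [LinearMap.trace_comp_comm', htrAR]
  have htrRR : LinearMap.trace ℝ E3 (R ∘ₗ R) = 0 := by
    rw [hR, comp_rankOne, rankOne_apply, hyAy, zero_smul, trace_rankOne, inner_zero_right]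
  have htrMM : LinearMap.trace ℝ E3 (M ∘ₗ M) =
      LinearMap.trace ℝ E3 (A ∘ₗ A) + 2 * c * ⟪w, A y⟫ := by
    rw [hMM, LinearMap.trace_comp_comm', LinearMap.comp_assoc, hXP]
    have e : X ∘ₗ X = A ∘ₗ A - c • (A ∘ₗ R) - c • (R ∘ₗ A) + (c * c) • (R ∘ₗ R) := by
      rw [hXdef]
      simp only [LinearMap.sub_comp, LinearMap.comp_sub, LinearMap.smul_comp, LinearMap.comp_smul, smul_sub,
        smul_smul]
      abel
    rw [e, map_add, map_sub, map_sub, map_smul, map_smul, map_smul, htrAR, htrRA, htrRR]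
    simp only [smul_eq_mul]
    ring
  -- `M` is self-adjoint
  have hMsym : ∀ a b : E3, ⟪M a, b⟫ = ⟪a, M b⟫ := by
    intro a b
    have e1 : M a = P (A (P a)) := rfl
    have e2 : M b = P (A (P b)) := rfl
    rw [e1, e2, inner_proj_symm, hsym (P a) (P b) (inner_proj_left y a hy) (inner_proj_left y b hy),
      ← inner_proj_symm]
    exact real_inner_comm _ _
  -- the traceless part `N = M − (tr M / 2) P`
  set t : ℝ := LinearMap.trace ℝ E3 A / 2 with ht
  set N := M - t • P with hN
  have hPsym : ∀ a b : E3, ⟪P a, b⟫ = ⟪a, P b⟫ := fun a b => inner_proj_symm y a b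
  have hNsym : ∀ a b : E3, ⟪N a, b⟫ = ⟪a, N b⟫ := by
    intro a b
    simp only [hN, LinearMap.sub_apply, LinearMap.smul_apply, inner_sub_left, inner_sub_right,
      real_inner_smul_left, real_inner_smul_right, hMsym a b, hPsym a b]
  have hMP : M ∘ₗ P = M := by rw [hM, LinearMap.comp_assoc, hXP]
  have hPM : P ∘ₗ M = M := by rw [hM, ← LinearMap.comp_assoc, hPP]
  have hNN : LinearMap.trace ℝ E3 (N ∘ₗ N) =
      LinearMap.trace ℝ E3 (M ∘ₗ M) - (LinearMap.trace ℝ E3 A) ^ 2 / 2 := by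
    have e : N ∘ₗ N = M ∘ₗ M - t • (M ∘ₗ P) - t • (P ∘ₗ M) + (t * t) • (P ∘ₗ P) := by
      rw [hN]
      simp only [LinearMap.sub_comp, LinearMap.comp_sub, LinearMap.smul_comp, LinearMap.comp_smul, smul_sub,
        smul_smul]
      abel
    rw [e, hMP, hPM, hPP, map_add, map_sub, map_sub, map_smul, map_smul, htrM, trace_proj hy]
    simp only [smul_eq_mul, ht]
    ring
  have h0 := trace_comp_self_nonneg hNsym
  rw [hNN, htrMM] at h0
  linarith




end Hodge

end Summit.NavierStokesRegularity.NavierStokesRegularity.Theorems.PoloidalLiouville.CentreVirial
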